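import Mathlib
import Summits.Ventures.PercRepro2.RootEdgeRow
import Summits.Ventures.PercRepro2.WeightedRowInactiveMin

/-!
# The root edge, III: `Ψ′ ≥ 0` (BHK 1.4 on `Q′`), `M ≥ Φ₁₁` from (3M) ∧ (F), and the weighted
(ROW-23-R) at a root edge of an `a₃`-inactive instance
(blind cell PercRepro2, night-3 g21, 2026-08-28; `proofs/NIGHT3-CERT.md` §30)

* **`psi'_nonneg`**: `Ψ′ ≥ 0` is `bhk_cross_cluster_avoid` with `s = a₂`, `t = a₁`, the avoided set
  `{a₁, v}` (BHK06 Thm 1.4 on `Q′ = {a₁ ↮ a₂, a₂ ↮ v}`).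
* **`Phi11_le_M_of_rootCross`**: g20's root-edge row candidate `M ≥ Φ₁₁` (§29.9b, 0 / 10,075;
  0 / 334,053 in kit j308130) ⟸ `RootCross` in both orientations `(b, o)`, `(o, b)`, by the two half
  identities of `RootEdgeRow.lean` (the candidate (F) of `RootEdgeCells.lean` is FALSE — see the
  correction there; `RootCross` = (3M)-term + (F)-term is what the census supports).
* **`wrow23R_rootEdge_of_a3Inactive`**: at a root edge `g` of an `a₃`-inactive instance (⟸ `RootCross`),
  `2 p_g² (1 − p_g) · Gc(p[g := 1]) ≤ T₂(p)` — the weighted (ROW-23-R) — from g20's row identity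
  `wrow23_slack_of_a3Inactive`, `Gc_eq_of_a3Inactive`, `Q` decreasing, BHK 1.4 for the contraction
  and `M ≥ Φ₁₁`.
* **`wrowMinR_rootEdge_of_a3Inactive`**: likewise `p_g (1 − p_g)² · Gc(p[g := 1]) ≤ T₁(p)` — the
  weighted (ROW-MIN-R) there — from g20's `wrow_one_of_a3Inactive`
  (`T₁ = 2 p_g (1 − p_g)² [q₁Φ₀₀ + q₀M]`) and `q₁Φ₀₀ + q₀M − q₁Φ₁₁ ≥ q₁(M − Φ₁₁) ≥ 0`.

Own work; standard axioms.
-/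

namespace Summit.Ventures.PercRepro2

open UnionCluster

namespace CovForm

namespace RootEdge

open A3Inactive

variable {V : Type*} {E : Type*} [Fintype E] [DecidableEq E] [DecidableEq V]
  {R : Type*} [Field R] [LinearOrder R] [IsStrictOrderedRing R]

/-! ## `Ψ′ ≥ 0` is BHK06 Thm 1.4 on `Q′` (the avoided set `{a₁, v}`) -/

omit [DecidableEq V] in
/-- **`Ψ′ ≥ 0`**: `bhk_cross_cluster_avoid` with `s = a₂`, `t = a₁`, `X = {a₁, v}`, up-sets
`{o ∈ ·}` for `C(a₂)` and `{b ∈ ·}` for `C(a₁)`. -/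
theorem psi'_nonneg [Fintype V] (p : E → R) (hp : IsProbVec p) (ends : E → Sym2 V)
    (a₁ a₂ b o v : V) :
    prob p {ω' | ω' ∈ avoidAll ends a₂ {a₁} ∧ ¬ Conn ends ω' a₂ v ∧ Conn ends ω' a₂ o ∧
          Conn ends ω' a₁ b} *
        prob p {ω' | ω' ∈ avoidAll ends a₂ {a₁} ∧ ¬ Conn ends ω' a₂ v} ≤
      prob p {ω' | ω' ∈ avoidAll ends a₂ {a₁} ∧ ¬ Conn ends ω' a₂ v ∧ Conn ends ω' a₁ b} *
        prob p {ω' | ω' ∈ avoidAll ends a₂ {a₁} ∧ ¬ Conn ends ω' a₂ v ∧ Conn ends ω' a₂ o} := by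
  classical
  have h := bhk_cross_cluster_avoid p hp ends a₂ a₁ (X := {a₁, v}) (Finset.mem_insert_self a₁ {v})
    (isUpperSet_mem_setOf o) (isUpperSet_mem_setOf b)
  rw [← connEvent_eq_clusterInEvent ends a₂ o, ← connEvent_eq_clusterInEvent ends a₁ b] at h
  have e0 : avoidAll ends a₂ {a₁, v} =
      {ω' | ω' ∈ avoidAll ends a₂ {a₁} ∧ ¬ Conn ends ω' a₂ v} := by
    ext ω'
    simp only [Set.mem_setOf_eq, mem_avoidAll, Finset.mem_insert, Finset.mem_singleton,
      forall_eq_or_imp, forall_eq]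
  have e1 : connEvent ends a₂ o ∩ connEvent ends a₁ b ∩ avoidAll ends a₂ {a₁, v} =
      {ω' | ω' ∈ avoidAll ends a₂ {a₁} ∧ ¬ Conn ends ω' a₂ v ∧ Conn ends ω' a₂ o ∧
        Conn ends ω' a₁ b} := by
    ext ω'
    simp only [Set.mem_inter_iff, Set.mem_setOf_eq, mem_connEvent, mem_avoidAll,
      Finset.mem_insert, Finset.mem_singleton, forall_eq_or_imp, forall_eq]
    tauto
  have e2 : connEvent ends a₂ o ∩ avoidAll ends a₂ {a₁, v} =
      {ω' | ω' ∈ avoidAll ends a₂ {a₁} ∧ ¬ Conn ends ω' a₂ v ∧ Conn ends ω' a₂ o} := by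
    ext ω'
    simp only [Set.mem_inter_iff, Set.mem_setOf_eq, mem_connEvent, mem_avoidAll,
      Finset.mem_insert, Finset.mem_singleton, forall_eq_or_imp, forall_eq]
    tauto
  have e3 : connEvent ends a₁ b ∩ avoidAll ends a₂ {a₁, v} =
      {ω' | ω' ∈ avoidAll ends a₂ {a₁} ∧ ¬ Conn ends ω' a₂ v ∧ Conn ends ω' a₁ b} := by
    ext ω'
    simp only [Set.mem_inter_iff, Set.mem_setOf_eq, mem_connEvent, mem_avoidAll,
      Finset.mem_insert, Finset.mem_singleton, forall_eq_or_imp, forall_eq]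
    tauto
  rw [e1, e2, e3, e0] at h
  linarith [h]


/-! ## `M ≥ Φ₁₁` at a root edge from (3M) and (F), and the weighted (ROW-23-R) there -/

omit [DecidableEq V] in
/-- **The root-edge row candidate `M ≥ Φ₁₁` (g20 §29.9b) ⟸ `RootCross` in both orientations**:
at a root edge `g = {a₁, v}`, with `P^s = p[g := s]`, `Φ₁₁ ≤ Φ₀₁ + Φ₁₀` (the mixed-BHK slack `M`
dominates the BHK slack of the contraction) — by the two half identities, `Ψ′ ≥ 0` twice (BHK 1.4 on
`Q′`), and `RootCross` for `(b, o)` and for `(o, b)`, all under `P⁰`. -/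
theorem Phi11_le_M_of_rootCross [Fintype V] (ends : E → Sym2 V) (o a₁ a₂ b v : V) {g : E}
    (hg : ends g = s(a₁, v))
    (hc : RootCross (R := R) ends a₁ a₂ b o v) (hc' : RootCross (R := R) ends a₁ a₂ o b v)
    (p : E → R) (hp : IsProbVec p) :
    (prob (Function.update p g 1) (avoidAll ends a₂ {a₁} ∩ connEvent ends a₁ b) *
          prob (Function.update p g 1) (avoidAll ends a₂ {a₁} ∩ connEvent ends a₂ o) -
        prob (Function.update p g 1) (avoidAll ends a₂ {a₁}) *
          prob (Function.update p g 1)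
            (avoidAll ends a₂ {a₁} ∩ (connEvent ends a₂ o ∩ connEvent ends a₁ b))) +
      (prob (Function.update p g 1) (avoidAll ends a₂ {a₁} ∩ connEvent ends a₂ b) *
          prob (Function.update p g 1) (avoidAll ends a₂ {a₁} ∩ connEvent ends a₁ o) -
        prob (Function.update p g 1) (avoidAll ends a₂ {a₁}) *
          prob (Function.update p g 1)
            (avoidAll ends a₂ {a₁} ∩ (connEvent ends a₁ o ∩ connEvent ends a₂ b))) ≤
    (prob (Function.update p g 0) (avoidAll ends a₂ {a₁} ∩ connEvent ends a₁ b) *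
          prob (Function.update p g 1) (avoidAll ends a₂ {a₁} ∩ connEvent ends a₂ o) +
        prob (Function.update p g 1) (avoidAll ends a₂ {a₁} ∩ connEvent ends a₁ b) *
          prob (Function.update p g 0) (avoidAll ends a₂ {a₁} ∩ connEvent ends a₂ o) +
        prob (Function.update p g 0) (avoidAll ends a₂ {a₁} ∩ connEvent ends a₂ b) *
          prob (Function.update p g 1) (avoidAll ends a₂ {a₁} ∩ connEvent ends a₁ o) +
        prob (Function.update p g 1) (avoidAll ends a₂ {a₁} ∩ connEvent ends a₂ b) *
          prob (Function.update p g 0) (avoidAll ends a₂ {a₁} ∩ connEvent ends a₁ o)) -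
      (prob (Function.update p g 0) (avoidAll ends a₂ {a₁}) *
          prob (Function.update p g 1)
            (avoidAll ends a₂ {a₁} ∩ (connEvent ends a₂ o ∩ connEvent ends a₁ b)) +
        prob (Function.update p g 1) (avoidAll ends a₂ {a₁}) *
          prob (Function.update p g 0)
            (avoidAll ends a₂ {a₁} ∩ (connEvent ends a₂ o ∩ connEvent ends a₁ b)) +
        prob (Function.update p g 0) (avoidAll ends a₂ {a₁}) *
          prob (Function.update p g 1)
            (avoidAll ends a₂ {a₁} ∩ (connEvent ends a₁ o ∩ connEvent ends a₂ b)) +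
        prob (Function.update p g 1) (avoidAll ends a₂ {a₁}) *
          prob (Function.update p g 0)
            (avoidAll ends a₂ {a₁} ∩ (connEvent ends a₁ o ∩ connEvent ends a₂ b))) := by
  have hp0 : IsProbVec (Function.update p g 0) := hp.update g le_rfl zero_le_one
  have h1 := half_identity p hg a₂ b o
  have h2 := half_identity p hg a₂ o b
  rw [Set.inter_comm (connEvent ends a₂ b) (connEvent ends a₁ o)] at h2
  have n1 := psi'_nonneg (Function.update p g 0) hp0 ends a₁ a₂ b o v
  have n2 := psi'_nonneg (Function.update p g 0) hp0 ends a₁ a₂ o b v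
  have c1 := hc (Function.update p g 0) hp0
  have c2 := hc' (Function.update p g 0) hp0
  linarith [h1, h2, n1, n2, c1, c2]

/-- **The weighted (ROW-23-R) at a root edge of an `a₃`-inactive instance ⟸ `RootCross`**:
`2 p_g² (1 − p_g) · Gc(p[g := 1]) ≤ T₂(p)` — the type-2 Bernstein coefficient of the one-edge cubic
at `g = {a₁, v}` is at least TWICE the contraction (g20 §29.9b: 0 / 1,559,142 exhaustive typed rows),
from g20's row identity `wrow23_slack_of_a3Inactive`, `Gc_eq_of_a3Inactive` for the contraction,
`Q` decreasing, BHK 1.4 for the contraction, and `Φ₁₁ ≤ M` above. -/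
theorem wrow23R_rootEdge_of_a3Inactive [Fintype V] (ends : E → Sym2 V) (o a₁ a₂ a₃ b v : V)
    {g : E} (hg : ends g = s(a₁, v))
    (hc : RootCross (R := R) ends a₁ a₂ b o v) (hc' : RootCross (R := R) ends a₁ a₂ o b v)
    (hinact : ∀ ω : Config E, ¬ Conn ends ω a₁ a₃ ∧ ¬ Conn ends ω a₂ a₃)
    (p : E → R) (hp : IsProbVec p) (τ : E → ℕ) (hτ : τ g = 2) :
    2 * (p g ^ 2 * (1 - p g)) * Gc (Function.update p g 1) ends o a₁ a₂ a₃ b ≤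
      triSum p {g} τ (K3 ends o a₁ a₂ a₃ b) := by
  have hid := wrow23_slack_of_a3Inactive p g τ hτ ends o a₁ a₂ a₃ b hinact
  have hG := Gc_eq_of_a3Inactive (Function.update p g 1) ends o a₁ a₂ a₃ b hinact
  have hM := Phi11_le_M_of_rootCross ends o a₁ a₂ b v hg hc hc' p hp
  have hq := prob_Q_update_one_le p hp ends a₁ a₂ g
  have hp1 : IsProbVec (Function.update p g 1) := hp.update g zero_le_one le_rfl
  have hΦ1 := bLoH_mul_Q_le (Function.update p g 1) hp1 ends o a₁ a₂ b
  have hΦ2 := bHoL_mul_Q_le (Function.update p g 1) hp1 ends o a₁ a₂ b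
  have hQ1 := prob_nonneg hp1 (avoidAll ends a₂ {a₁})
  have hc : 0 ≤ 2 * (p g ^ 2 * (1 - p g)) :=
    mul_nonneg (by norm_num) (mul_nonneg (pow_nonneg (hp.nonneg g) 2)
      (sub_nonneg.mpr (hp.le_one g)))
  rw [← sub_nonneg, hG]
  have key : 0 ≤ triSum p {g} τ (K3 ends o a₁ a₂ a₃ b) -
      2 * (p g ^ 2 * (1 - p g)) * Gc (Function.update p g 1) ends o a₁ a₂ a₃ b := by
    rw [hG]
    nlinarith [hid, hM, hq, hΦ1, hΦ2, hQ1, hc, mul_nonneg hc (mul_nonneg hQ1 (sub_nonneg.mpr hM)),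
      mul_nonneg hc (mul_nonneg (sub_nonneg.mpr hq) (by linarith [hΦ1, hΦ2] :
        (0 : R) ≤ (prob (Function.update p g 1) (avoidAll ends a₂ {a₁} ∩ connEvent ends a₁ b) *
          prob (Function.update p g 1) (avoidAll ends a₂ {a₁} ∩ connEvent ends a₂ o) -
        prob (Function.update p g 1) (avoidAll ends a₂ {a₁}) *
          prob (Function.update p g 1)
            (avoidAll ends a₂ {a₁} ∩ (connEvent ends a₂ o ∩ connEvent ends a₁ b))) +
        (prob (Function.update p g 1) (avoidAll ends a₂ {a₁} ∩ connEvent ends a₂ b) *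
          prob (Function.update p g 1) (avoidAll ends a₂ {a₁} ∩ connEvent ends a₁ o) -
        prob (Function.update p g 1) (avoidAll ends a₂ {a₁}) *
          prob (Function.update p g 1)
            (avoidAll ends a₂ {a₁} ∩ (connEvent ends a₁ o ∩ connEvent ends a₂ b)))))]
  rw [hG] at key
  exact key

/-- **The weighted (ROW-MIN-R) at a root edge of an `a₃`-inactive instance ⟸ `RootCross`**:
`p_g (1 − p_g)² · Gc(p[g := 1]) ≤ T₁(p)` — the type-1 Bernstein coefficient of the one-edge cubic at
`g = {a₁, v}` dominates the contraction (g20 §29.9: 0 / 7,491,265 exhaustive typed rows), from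
g20's `wrow_one_of_a3Inactive`, `Gc_eq_of_a3Inactive`, `Q` decreasing, BHK 1.4 for the deletion
and `Φ₁₁ ≤ M` above. -/
theorem wrowMinR_rootEdge_of_a3Inactive [Fintype V] (ends : E → Sym2 V) (o a₁ a₂ a₃ b v : V)
    {g : E} (hg : ends g = s(a₁, v))
    (hc : RootCross (R := R) ends a₁ a₂ b o v) (hc' : RootCross (R := R) ends a₁ a₂ o b v)
    (hinact : ∀ ω : Config E, ¬ Conn ends ω a₁ a₃ ∧ ¬ Conn ends ω a₂ a₃)
    (p : E → R) (hp : IsProbVec p) (τ : E → ℕ) (hτ : τ g = 1) :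
    p g * (1 - p g) ^ 2 * Gc (Function.update p g 1) ends o a₁ a₂ a₃ b ≤
      triSum p {g} τ (K3 ends o a₁ a₂ a₃ b) := by
  have hid := wrow_one_of_a3Inactive p g τ hτ ends o a₁ a₂ a₃ b hinact
  have hG := Gc_eq_of_a3Inactive (Function.update p g 1) ends o a₁ a₂ a₃ b hinact
  have hM := Phi11_le_M_of_rootCross ends o a₁ a₂ b v hg hc hc' p hp
  have hq := prob_Q_update_one_le p hp ends a₁ a₂ g
  have hp1 : IsProbVec (Function.update p g 1) := hp.update g zero_le_one le_rfl
  have hp0 : IsProbVec (Function.update p g 0) := hp.update g le_rfl zero_le_one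
  have hΦ1 := bLoH_mul_Q_le (Function.update p g 1) hp1 ends o a₁ a₂ b
  have hΦ2 := bHoL_mul_Q_le (Function.update p g 1) hp1 ends o a₁ a₂ b
  have hΦ01 := bLoH_mul_Q_le (Function.update p g 0) hp0 ends o a₁ a₂ b
  have hΦ02 := bHoL_mul_Q_le (Function.update p g 0) hp0 ends o a₁ a₂ b
  have hQ1 := prob_nonneg hp1 (avoidAll ends a₂ {a₁})
  have hQ0 := prob_nonneg hp0 (avoidAll ends a₂ {a₁})
  have hc : 0 ≤ 2 * (p g * (1 - p g) ^ 2) :=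
    mul_nonneg (by norm_num) (mul_nonneg (hp.nonneg g) (pow_nonneg (sub_nonneg.mpr (hp.le_one g)) 2))
  rw [← sub_nonneg, hG, hid]
  -- `T₁ − p(1−p)²·2q₁Φ₁₁ = 2p(1−p)²·[q₁Φ₀₀ + q₀M − q₁Φ₁₁]`, and the bracket is
  -- `q₁Φ₀₀ + (q₀ − q₁)M + q₁(M − Φ₁₁) ≥ 0`
  nlinarith [mul_nonneg hc (mul_nonneg hQ1 (by linarith [hΦ01, hΦ02] : (0 : R) ≤
      (prob (Function.update p g 0) (avoidAll ends a₂ {a₁} ∩ connEvent ends a₁ b) *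
          prob (Function.update p g 0) (avoidAll ends a₂ {a₁} ∩ connEvent ends a₂ o) -
        prob (Function.update p g 0) (avoidAll ends a₂ {a₁}) *
          prob (Function.update p g 0)
            (avoidAll ends a₂ {a₁} ∩ (connEvent ends a₂ o ∩ connEvent ends a₁ b))) +
        (prob (Function.update p g 0) (avoidAll ends a₂ {a₁} ∩ connEvent ends a₂ b) *
          prob (Function.update p g 0) (avoidAll ends a₂ {a₁} ∩ connEvent ends a₁ o) -
        prob (Function.update p g 0) (avoidAll ends a₂ {a₁}) *
          prob (Function.update p g 0)
            (avoidAll ends a₂ {a₁} ∩ (connEvent ends a₁ o ∩ connEvent ends a₂ b))))),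
    mul_nonneg hc (mul_nonneg (sub_nonneg.mpr hq) (by linarith [hM, hΦ1, hΦ2] : (0 : R) ≤
      (prob (Function.update p g 0) (avoidAll ends a₂ {a₁} ∩ connEvent ends a₁ b) *
          prob (Function.update p g 1) (avoidAll ends a₂ {a₁} ∩ connEvent ends a₂ o) +
        prob (Function.update p g 1) (avoidAll ends a₂ {a₁} ∩ connEvent ends a₁ b) *
          prob (Function.update p g 0) (avoidAll ends a₂ {a₁} ∩ connEvent ends a₂ o) +
        prob (Function.update p g 0) (avoidAll ends a₂ {a₁} ∩ connEvent ends a₂ b) *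
          prob (Function.update p g 1) (avoidAll ends a₂ {a₁} ∩ connEvent ends a₁ o) +
        prob (Function.update p g 1) (avoidAll ends a₂ {a₁} ∩ connEvent ends a₂ b) *
          prob (Function.update p g 0) (avoidAll ends a₂ {a₁} ∩ connEvent ends a₁ o)) -
      (prob (Function.update p g 0) (avoidAll ends a₂ {a₁}) *
          prob (Function.update p g 1)
            (avoidAll ends a₂ {a₁} ∩ (connEvent ends a₂ o ∩ connEvent ends a₁ b)) +
        prob (Function.update p g 1) (avoidAll ends a₂ {a₁}) *
          prob (Function.update p g 0)
            (avoidAll ends a₂ {a₁} ∩ (connEvent ends a₂ o ∩ connEvent ends a₁ b)) +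
        prob (Function.update p g 0) (avoidAll ends a₂ {a₁}) *
          prob (Function.update p g 1)
            (avoidAll ends a₂ {a₁} ∩ (connEvent ends a₁ o ∩ connEvent ends a₂ b)) +
        prob (Function.update p g 1) (avoidAll ends a₂ {a₁}) *
          prob (Function.update p g 0)
            (avoidAll ends a₂ {a₁} ∩ (connEvent ends a₁ o ∩ connEvent ends a₂ b))))),
    mul_nonneg hc (mul_nonneg hQ1 (sub_nonneg.mpr hM))]

end RootEdge

end CovForm

end Summit.Ventures.PercRepro2
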